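import Summits.QuantumFields.YangMills.Theorems.BalabanUVNodesN11NoExpansionOldFactors
import Literature.MathematicalPhysics.QuantumFieldTheory.Balaban1983to89.Node00.Record13SepCoPHChi
import Literature.MathematicalPhysics.QuantumFieldTheory.Balaban1983to89.Node00.Record13ResidualsRChi
import Summits.QuantumFields.YangMills.Theorems.BalabanUVNodesN11NoExpansionAtRecord13CoPChi
import Summits.QuantumFields.YangMills.Theorems.BalabanUVNodesN11NoExpansionDiagonalCoPHChi
import Summits.QuantumFields.YangMills.Theorems.BalabanUVNodesN11BackgroundScaleLocalChi

/-!
# χ-GENERIC RE-ISSUE (WORK ORDER RC-1 «RE-CENTRE THE RECORD», director-ym №462 (B) ∕ №467 (D)) of `BalabanUVNodesN11NoExpansionOldFactors`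

Cell `pub-ymgap` (HUMAN RULING D-0062, Track A), seat `pub-ymgap-dag-n11-d` (N11 [B14] s2; N11-σ campaign, `N11-G44-RC1-REACH-CENSUS.md`).  The CENTRE-TYPED
declarations of `BalabanUVNodesN11NoExpansionOldFactors` (those whose statement reads the (2.9) cut-off centre through `gOfRecord₁₃ ∕ EOfRecord₁₃ ∕ Provisos₁₃… ∕ T∕SLaw₁₃… ∕
UbgOfRecord₁₃… ∕ WtOfRecord₁₃… ∕ datum∕tower∕coreOfRecord₁₃…`) RE-ISSUED VERBATIM in the β-slot `χ : ChiSlot F N` over [Ax-3b]∕[Ax-3c]∕[Ax-3d]'s χ-generic carriers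
(`Node00/Record13Chi` ∕ `Record13CoPHChi` ∕ `Record13SepCoPHChi`): σ = (binder `(χ : ChiSlot F N)` after `θ`; Node00 defs `X ↦ XChi … χ`; Node00 rows `Y ↦ Y_chi`;
this lane's sibling modules `…Chi` for Summits-side dependencies); SAME short names in the sibling namespace `…BalabanUVNodesN11NoExpansionOldFactorsChi` (consumers switch by namespace);
the 3 centre-FREE declarations of the original are NOT copied — they are reused BY NAME (`open … (…)` below).  At `χ := chiβOfRecord₁₃ θ` every statement here is
DEFINITIONALLY the landed one ([Ax-3b]'s `rfl` receipts); at `χ := chiβOfRecord₁₃Ax θ` it is what the Ax-record's N11 machine reads.  Nothing of record edited (body-freeze №460 (2)).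

HONEST FRAMING.  Count-neutral kernel re-elaboration of landed N11 bookkeeping∕estimates in a parameter; every HYPOTHESIS of the original stays a hypothesis; nothing of
Bałaban asserted beyond what the original file proves; N11 NOT discharged; K-items untouched; counts unmoved.  One finite `𝕋⁴_{L^K}` programme at fixed `ε = L^{−K}` —
NOT ℝ⁴, NOT OS, NOT a mass gap, NOT Clay.  No `sorry`∕`instance`∕`notation`.  Sources: as the original module, plus [I] = [Balaban1987RG1] (2.9) p.266 (the cut-off's centre).
-/

noncomputable section

open MeasureTheory
open scoped BigOperators Matrix.Norms.L2Operator

namespace Summit.QuantumFields.YangMills.Theorems.BalabanUVNodesN11NoExpansionOldFactorsChi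

open Summit.QuantumFields.YangMills.Theorems.BalabanUVNodesN11NoExpansionOldFactors (action23_congr_fluct_of_B_local clause_succ_of_Omega_empty_of_pinChi_of_clause clause_succ_of_Omega_empty_of_prefix_of_clause)
open Literature.MathematicalPhysics.QuantumFieldTheory.Balaban1983to89 T4Continuum Node00 Node00.Tk DagBinding
open B15DeterminingSets
open BalabanUVNodesN11NoExpansionActionSucc (exp_action23_succ_eq_init_of_Omega_empty)
open BalabanUVNodesN11NoExpansionAtRecord13CoPChi (UbgOfRecord₁₃CoP_succ_eq_init_of_Omega_empty UbgOfRecord₁₃CoP_one_eq_init_of_Omega_empty)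
open BalabanUVNodesN11TkBranchLinearLocal (tkBranchOfRecord_const_mul tkBranchOfRecord_pairCfgAt_eq_baseCfg)
open BalabanUVNodesN11BackgroundScaleLocalChi (UbgOfRecord₁₃CoP_congr_of_agree_le)
open BalabanUVNodesN11TkBranchWeightCongr (sect2Slot_congr_of_weights tkWeightsOfRecordP_ζ_congr tkWeightsOfRecordP_w_congr)
open BalabanUVNodesN11NoExpansionGeneralStep (clause_succ_of_zetaSpecChiAt_of_clause)
open BalabanUVNodesN11NoExpansionDiagonalCoPH (sect2Slot_congr_residual sect2Operand_congr_residual)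
open BalabanUVNodesN11NoExpansionDiagonalCoPHChi (WtOfRecord₁₃H_eq_tkWeightsOfRecordP)

variable {F : T4Family} {N : ℕ} [NeZero N]

/-! ## §1. ★ (3.24) derived: the old factors agree at a no-expansion step after any history -/

section OldFactors

variable (θ : Stage13Params F N) (χ : ChiSlot F N) (p : B12.RunParams)

/-- **def-R's `CoP` BACKGROUND MAP IS UNCHANGED ALONG A NO-EXPANSION STEP, POINTWISE, EVERY `k`** (p526149's `k ≥ 1` equation and `k = 0` face together).
[cite: Balaban1988Convergent, (2.12)–(2.13) pp.256–257, Thm 1 p.262] -/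
theorem UbgOfRecord₁₃CoP_succ_apply_eq_init_of_Omega_empty {k : ℕ}
    (s : SeqOfRecord F θ.ν θ.τ9.M (gOfRecord₁₃Chi F N θ χ p) p.K (k + 1)) (hΩ : s.Ω (k + 1) = ∅) (W : MSField (F.P p.K) (SU N)) :
    UbgOfRecord₁₃CoPChi F N θ χ p (k + 1) s W = UbgOfRecord₁₃CoPChi F N θ χ p k s.init W := by
  rcases Nat.eq_zero_or_pos k with hk0 | hkpos
  · subst hk0
    exact UbgOfRecord₁₃CoP_one_eq_init_of_Omega_empty θ χ p s hΩ W
  · rw [UbgOfRecord₁₃CoP_succ_eq_init_of_Omega_empty θ χ p hkpos s hΩ]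

/-- **THE NEW OPERAND IS A CONSTANT MULTIPLE OF THE OLD ONE at a no-expansion step, any history, SAME witness** (p531413's (2.22) + the unchanged background):
`e^{A_{k+1}(s′)[t, a](U_{k+1}(s′)(𝐖))} = e^{E_k − E_{k+1}}·e^{A_k(init s′)[t, a](U_k(init s′)(𝐖))}` (`M ≥ 1`; any two residual data, by residual irrelevance).
[cite: Balaban1988Convergent, (2.22)–(2.23) p.258, (3.24) p.270] -/
theorem sect2Operand_succ_eq_const_mul_of_Omega_empty (hM : 1 ≤ θ.τ9.M) {k : ℕ}
    (s : SeqOfRecord F θ.ν θ.τ9.M (gOfRecord₁₃Chi F N θ χ p) p.K (k + 1)) (hΩ : s.Ω (k + 1) = ∅)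
    (Rz Rz' : Sect2.Residual (F.P p.K) (MatA N)) (t : Sect2.TermValues (F.P p.K) (MatA N) (FluctV N) θ.τ9.M) (Ek Ek' : ℝ)
    (a : Tk.SFluct (F.P p.K) (FluctV N)) (W : MSField (F.P p.K) (SU N)) :
    sect2Operand F N (FluctV N) p.K (settingOfRecord₁₃Chi F N θ χ p) Rz' s t Ek' (UbgOfRecord₁₃CoPChi F N θ χ p (k + 1) s) a W =
      Real.exp (Ek - Ek') * sect2Operand F N (FluctV N) p.K (settingOfRecord₁₃Chi F N θ χ p) Rz s.init t Ek (UbgOfRecord₁₃CoPChi F N θ χ p k s.init) a W := by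
  rw [sect2Operand_congr_residual (settingOfRecord₁₃Chi F N θ χ p) Rz' Rz s t Ek' (UbgOfRecord₁₃CoPChi F N θ χ p (k + 1) s)]
  show Real.exp ((sect2ActionDataOfRecord F N (FluctV N) p.K (settingOfRecord₁₃Chi F N θ χ p) Rz s t a Ek').action23 (k + 1)
      (UbgOfRecord₁₃CoPChi F N θ χ p (k + 1) s W)) =
    Real.exp (Ek - Ek') * Real.exp ((sect2ActionDataOfRecord F N (FluctV N) p.K (settingOfRecord₁₃Chi F N θ χ p) Rz s.init t a Ek).action23 k
      (UbgOfRecord₁₃CoPChi F N θ χ p k s.init W))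
  rw [UbgOfRecord₁₃CoP_succ_apply_eq_init_of_Omega_empty θ χ p s hΩ W]
  exact exp_action23_succ_eq_init_of_Omega_empty (settingOfRecord₁₃Chi F N θ χ p) Rz hM s hΩ t a Ek Ek' _

/-- **THE OLD OPERAND IS `k`-LOCAL in the all-scales configuration** when its action is `k`-local in the fluctuation argument (`hA`, displayed: the 𝐁-terms) — the
background `U_k(init s′)(𝐖)` reads `𝐖 i`, `i ≤ k` only ((BL), p536754). [cite: Balaban1988Convergent, (2.23) p.258, (2.40) p.261, (2.12) p.256] -/
theorem sect2Operand_old_local {k : ℕ} (s : SeqOfRecord F θ.ν θ.τ9.M (gOfRecord₁₃Chi F N θ χ p) p.K (k + 1))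
    (Rz : Sect2.Residual (F.P p.K) (MatA N)) (t : Sect2.TermValues (F.P p.K) (MatA N) (FluctV N) θ.τ9.M) (Ek : ℝ) (S : ℕ → Set (Site (F.P p.K) 0))
    (hA : ∀ (a a' : Tk.MSFluct (F.P p.K) (FluctV N)) (Uf : GaugeField (F.P p.K) 0 (SU N)), (∀ i, i ≤ k → a i = a' i) →
      (sect2ActionDataOfRecord F N (FluctV N) p.K (settingOfRecord₁₃Chi F N θ χ p) Rz s.init t (S, a) Ek).action23 k Uf =
        (sect2ActionDataOfRecord F N (FluctV N) p.K (settingOfRecord₁₃Chi F N θ χ p) Rz s.init t (S, a') Ek).action23 k Uf)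
    (ω ω' : MultiCfg (F.P p.K) (SU N) (FluctV N)) (h : ∀ i, i ≤ k → ω i = ω' i) :
    sect2Operand F N (FluctV N) p.K (settingOfRecord₁₃Chi F N θ χ p) Rz s.init t Ek (UbgOfRecord₁₃CoPChi F N θ χ p k s.init) (S, fun j => (ω j).2) (fun j => (ω j).1) =
      sect2Operand F N (FluctV N) p.K (settingOfRecord₁₃Chi F N θ χ p) Rz s.init t Ek (UbgOfRecord₁₃CoPChi F N θ χ p k s.init) (S, fun j => (ω' j).2)
        (fun j => (ω' j).1) := by
  show Real.exp ((sect2ActionDataOfRecord F N (FluctV N) p.K (settingOfRecord₁₃Chi F N θ χ p) Rz s.init t (S, fun j => (ω j).2) Ek).action23 k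
      (UbgOfRecord₁₃CoPChi F N θ χ p k s.init (fun j => (ω j).1))) =
    Real.exp ((sect2ActionDataOfRecord F N (FluctV N) p.K (settingOfRecord₁₃Chi F N θ χ p) Rz s.init t (S, fun j => (ω' j).2) Ek).action23 k
      (UbgOfRecord₁₃CoPChi F N θ χ p k s.init (fun j => (ω' j).1)))
  rw [UbgOfRecord₁₃CoP_congr_of_agree_le θ χ p k s.init (W := fun j => (ω j).1) (W' := fun j => (ω' j).1) (fun i hi => by rw [h i hi]),
    hA (fun j => (ω j).2) (fun j => (ω' j).2) _ (fun i hi => by rw [h i hi])]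

/-- **★ (3.24) DERIVED — «THE OLD FACTORS AGREE» AT A NO-EXPANSION STEP AFTER AN ARBITRARY HISTORY.**  For `s′` with `Ω_{k+1}(s′) = ∅`, any weight family `W`
whose `ζ_j`, `w_j` (`j < k`) are `k`-local (`hζloc`, `hwloc`), any witness `t` whose old action is `k`-local in the fluctuation argument (`hA`), constants `E_k`,
`E_{k+1}`, any residual pair: for every old branch `S`, `𝐓_k(init s′, S)[e^{A_{k+1}(s′)}]_S (U, V′) = e^{E_k − E_{k+1}}·𝐓_k(init s′, S)[e^{A_k(init s′)}]_S (U)`.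
(2.22) makes the operands proportional; (L) pulls the constant out; (SL) moves the two-scale configuration to the base one.
[cite: Balaban1988Convergent, (3.24) p.270, (2.20)–(2.23) p.258, (2.40) p.261] -/
theorem oldFactors_agree_of_Omega_empty (hM : 1 ≤ θ.τ9.M) {k : ℕ}
    (s : SeqOfRecord F θ.ν θ.τ9.M (gOfRecord₁₃Chi F N θ χ p) p.K (k + 1)) (hΩ : s.Ω (k + 1) = ∅) (W : TkWeights F N (FluctV N) p.K)
    (hζloc : ∀ j, j < k → ∀ ω ω' : MultiCfg (F.P p.K) (SU N) (FluctV N), (∀ i, i ≤ k → ω i = ω' i) →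
      W.ζ j (s.init.Ω (j + 1))ᶜ ω = W.ζ j (s.init.Ω (j + 1))ᶜ ω')
    (S : ℕ → Set (Site (F.P p.K) 0))
    (hwloc : ∀ j, j < k → ∀ ω ω' : MultiCfg (F.P p.K) (SU N) (FluctV N), (∀ i, i ≤ k → ω i = ω' i) →
      W.w j (s.init.Λ (j + 1)) ((s.init.Λ (j + 1))ᶜ ∩ s.init.Ω (j + 1)) (S (j + 1)) ω =
        W.w j (s.init.Λ (j + 1)) ((s.init.Λ (j + 1))ᶜ ∩ s.init.Ω (j + 1)) (S (j + 1)) ω')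
    (Rz Rz' : Sect2.Residual (F.P p.K) (MatA N)) (t : Sect2.TermValues (F.P p.K) (MatA N) (FluctV N) θ.τ9.M) (Ek Ek' : ℝ)
    (hA : ∀ (a a' : Tk.MSFluct (F.P p.K) (FluctV N)) (Uf : GaugeField (F.P p.K) 0 (SU N)), (∀ i, i ≤ k → a i = a' i) →
      (sect2ActionDataOfRecord F N (FluctV N) p.K (settingOfRecord₁₃Chi F N θ χ p) Rz s.init t (S, a) Ek).action23 k Uf =
        (sect2ActionDataOfRecord F N (FluctV N) p.K (settingOfRecord₁₃Chi F N θ χ p) Rz s.init t (S, a') Ek).action23 k Uf)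
    (V' : GaugeField (F.P p.K) (k + 1) (SU N)) (U₀ : GaugeField (F.P p.K) k (SU N)) :
    tkBranchOfRecord F N (FluctV N) θ.ν θ.τ9.M _ p.K W s.init S k
        (fun ω => sect2Operand F N (FluctV N) p.K (settingOfRecord₁₃Chi F N θ χ p) Rz' s t Ek' (UbgOfRecord₁₃CoPChi F N θ χ p (k + 1) s)
          (S, fun j => (ω j).2) (fun j => (ω j).1))
        (pairCfgAt (V := FluctV N) k V' U₀) =
      Real.exp (Ek - Ek') * tkBranchOfRecord F N (FluctV N) θ.ν θ.τ9.M _ p.K W s.init S k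
        (fun ω => sect2Operand F N (FluctV N) p.K (settingOfRecord₁₃Chi F N θ χ p) Rz s.init t Ek (UbgOfRecord₁₃CoPChi F N θ χ p k s.init)
          (S, fun j => (ω j).2) (fun j => (ω j).1))
        (baseCfg (V := FluctV N) k U₀) := by
  have hop : (fun ω : MultiCfg (F.P p.K) (SU N) (FluctV N) =>
        sect2Operand F N (FluctV N) p.K (settingOfRecord₁₃Chi F N θ χ p) Rz' s t Ek' (UbgOfRecord₁₃CoPChi F N θ χ p (k + 1) s)
          (S, fun j => (ω j).2) (fun j => (ω j).1)) =
      fun ω => Real.exp (Ek - Ek') * sect2Operand F N (FluctV N) p.K (settingOfRecord₁₃Chi F N θ χ p) Rz s.init t Ek (UbgOfRecord₁₃CoPChi F N θ χ p k s.init)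
          (S, fun j => (ω j).2) (fun j => (ω j).1) :=
    funext fun ω => sect2Operand_succ_eq_const_mul_of_Omega_empty θ χ p hM s hΩ Rz Rz' t Ek Ek' _ _
  rw [hop, tkBranchOfRecord_const_mul]
  congr 1
  exact tkBranchOfRecord_pairCfgAt_eq_baseCfg θ.ν θ.τ9.M _ p.K W s.init S hζloc hwloc (sect2Operand_old_local θ χ p s Rz t Ek S hA) V' U₀

end OldFactors

/-! ## §2. ★★ The general clause-keyed no-expansion step at one weight family -/

section GeneralStep

variable (θ : Stage13Params F N) (χ : ChiSlot F N) (p : B12.RunParams)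

end GeneralStep

/-! ## §3. ★★ Two weight families agreeing below generation `k` (the v1.7 situation: weights of `s′` vs weights of `init s′`) -/

section Prefix

variable (θ : Stage13Params F N) (χ : ChiSlot F N) (p : B12.RunParams)

end Prefix

end Summit.QuantumFields.YangMills.Theorems.BalabanUVNodesN11NoExpansionOldFactorsChi

end
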